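import Mathlib
import Summits.KontsevichZagierPeriods.Zeta5Search.Elimination.PencilDescent
import HarnessLib

/-!
HONEST FRAMING: systematic search; no irrationality claim unless certified — identities and finite bookkeeping only.

# The descent with the dictionary pencil family thinned to the axis ray and the level-1 bases

fam-elim (class `elim`), gen 24, E-L23b — sequel to `Elimination/PencilDescent.lean` (E-L23: gen-1's descent
`WedgeDictionary.explicitPQ_of_terminal` with `DictPencil` replaced by `DictPencilZero`, the stratum `c_i = 0`).
Routing the pencil step to a slot of MAXIMAL value whenever that slot is interior (`b_i ≥ 2`, `b_i + 2 ≤ N`: then the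
tree theorem `Elimination.PencilBridge.dictPencil_at` applies at the base `a − DS`, by `nonEpair_sum_le_of_max`) leaves
exactly two kinds of interior points: the ray `(N;1⁷)` (all slots `1`; base on the axis `(N−2;0⁷)`) and the points of
level `3` with a slot `2` (13 region points; base of level `1`, and slot 1 or slot 2 equals `1` because `(1,2)` is an
E-pair).  Hence **`explicitPQ_of_terminal_sharp`**: gen-1's descent theorem with `DictPencil` replaced by the two thin
nodes `DictPencilAxis` (ONE instance per level) and `DictPencilLevelOne` (FINITELY many instances), both restrictions of
`DictPencilZero`; via `explicitPQ_of_provider`, the descent from an abstract provider of one dictionary pencil instance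
per interior point (gen-1's level descent verbatim except the pencil branch).  Census: memo `pub-zeta5-fam-elim/g24/BOUNDARY.md` §8–§9.
What this is NOT: anything about sizes, denominators or irrationality; `DictStar` (consumed only at zero-slot points),
`CellStar`, `CellPencil` and the two thin nodes remain hypotheses; the class verdict is unchanged (T1 NO / T2 NO / T4 YES).
-/

open Finset

namespace Summit.KontsevichZagierPeriods.Zeta5Search.Elimination

open Summit.KontsevichZagierPeriods.Zeta5Search.WedgeDictionary
open Literature.NumberTheory.Irrationality.BrownZudilin2022 (bOfA Converges convergenceForms)

/-! ## 1. The two thin nodes and the sharp routing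

With the slot chosen as "a slot of maximal value whenever that slot is interior", the node `DictPencilZero` of
`PencilDescent.lean` is consumed only at the bases of the ray `(N;1⁷)` (base `(N−2;0⁷)`, slot `1`) and at level-1 bases (the 13 region points of level 3 with slots
in `{1,2}`; census §8): two thinner nodes. -/

/-- **PENCIL, dictionary side, at the AXIS bases `(M;0⁷)`, slot 1 (INTERNALLY MINTED; conjecture)** — the instances
of `DictPencil` consumed by the re-routed descent at the ray `(N;1⁷)`.  One base per level. -/
@[conjecture] def DictPencilAxis : Prop :=
  ∀ (a : Fin 8 → ℤ) (j₀ j₁ j₂ : ℕ), (∀ m ∈ Icc 1 7, bOfA a m = 0) →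
    RegionHyp a j₀ → RegionHyp (a + dsUp) j₁ → RegionHyp (a + dsUp + slotDown 1) j₂ →
      DictThreeTerm (pencilBase (bOfA a)) (pencilApex (bOfA a) 1) (fanCoeff (bOfA (a + dsUp)) 1)
        a (a + dsUp) (a + dsUp + slotDown 1) j₀ j₁ j₂

/-- **PENCIL, dictionary side, at LEVEL-1 bases with `c_i = 0` (INTERNALLY MINTED; conjecture; FINITELY MANY
instances)** — consumed by the re-routed descent only at the 13 region points of level 3 with a slot equal to 2. -/
@[conjecture] def DictPencilLevelOne : Prop :=
  ∀ (a : Fin 8 → ℤ) (i j₀ j₁ j₂ : ℕ), i ∈ Icc 1 7 → bOfA a 0 = 1 → bOfA a i = 0 →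
    RegionHyp a j₀ → RegionHyp (a + dsUp) j₁ → RegionHyp (a + dsUp + slotDown i) j₂ →
      DictThreeTerm (pencilBase (bOfA a)) (pencilApex (bOfA a) i) (fanCoeff (bOfA (a + dsUp)) i)
        a (a + dsUp) (a + dsUp + slotDown i) j₀ j₁ j₂

/-- Shape sanity: the axis node is a restriction of `DictPencilZero`. -/
theorem dictPencilAxis_of_zero (h : DictPencilZero) : DictPencilAxis :=
  fun a j₀ j₁ j₂ hz h₀ h₁ h₂ => h a 1 j₀ j₁ j₂ (by simp) (hz 1 (by simp)) h₀ h₁ h₂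

/-- Shape sanity: the level-1 node is a restriction of `DictPencilZero`. -/
theorem dictPencilLevelOne_of_zero (h : DictPencilZero) : DictPencilLevelOne :=
  fun a i j₀ j₁ j₂ hi _ hz h₀ h₁ h₂ => h a i j₀ j₁ j₂ hi hz h₀ h₁ h₂

/-- **The dictionary pencil instance, sharp routing**: at a slot of maximal value when that slot is interior
(`b_i ≥ 2`, `b_i + 2 ≤ N`; theorem `dictPencil_at`), else the point is the ray point `(N;1⁷)` (node `DictPencilAxis`) or
has level `3` with a slot equal to `1` (node `DictPencilLevelOne`). -/
theorem pencil_instance_sharp (hAx : DictPencilAxis) (hL1 : DictPencilLevelOne) {a : Fin 8 → ℤ} {j : ℕ}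
    (hr : RegionHyp a j) (hpos : ∀ m ∈ Icc 1 7, 1 ≤ bOfA a m) :
    ∃ i ∈ Icc 1 7, DictThreeTerm (pencilBase (bOfA (a - dsUp))) (pencilApex (bOfA (a - dsUp)) i)
      (fanCoeff (bOfA (a - dsUp + dsUp)) i) (a - dsUp) (a - dsUp + dsUp) (a - dsUp + dsUp + slotDown i) j j j := by
  have hca : a - dsUp + dsUp = a := sub_add_cancel a dsUp
  have r₀ : RegionHyp (a - dsUp) j := regionHyp_sub_dsUp hr hpos
  have r₁ : RegionHyp (a - dsUp + dsUp) j := by rw [hca]; exact hr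
  have r₂ : ∀ {m : ℕ}, m ∈ Icc 1 7 → RegionHyp (a - dsUp + dsUp + slotDown m) j := fun hm => by
    rw [hca]; exact regionHyp_slotDown hr hm (hpos _ hm)
  obtain ⟨i, hi, hmax⟩ := exists_max_image (Icc 1 7) (bOfA a) ⟨1, by simp⟩
  have hi7 : i ≤ 7 := (mem_Icc.1 hi).2
  have hi0 : i ≠ 0 := by have := (mem_Icc.1 hi).1; omega
  have hNE := nonEpair_sum_le_of_max hr hi hmax
  obtain ⟨-, hconv, hbox, -, -⟩ := hr
  have hF := forms_of_converges hconv
  have hbi := hbox i hi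
  by_cases hint : 2 ≤ bOfA a i ∧ bOfA a i + 2 ≤ bOfA a 0
  · -- interior: the tree theorem at the base `a − DS`, slot `i`
    refine ⟨i, hi, dictPencil_at (a - dsUp) i j j j hi r₀ r₁ (r₂ hi) ?_ ?_ ?_⟩
    · rw [bOfA_sub_dsUp a i hi7, if_neg hi0]; omega
    · rw [bOfA_sub_dsUp a i hi7, if_neg hi0, bOfA_sub_dsUp a 0 (by norm_num), if_pos rfl]; omega
    · intro jk hjk h1 h2
      have hle := hNE jk hjk h1 h2
      have hjk' : jk.1 ≤ 7 ∧ jk.2 ≤ 7 ∧ jk.1 ≠ 0 ∧ jk.2 ≠ 0 := by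
        simp only [nonEpairs, List.mem_cons, List.not_mem_nil, or_false] at hjk
        rcases hjk with rfl | rfl | rfl | rfl | rfl | rfl <;> simp
      rw [bOfA_sub_dsUp a jk.1 hjk'.1, if_neg hjk'.2.2.1, bOfA_sub_dsUp a jk.2 hjk'.2.1, if_neg hjk'.2.2.2,
        bOfA_sub_dsUp a 0 (by norm_num), if_pos rfl]
      omega
  · by_cases hone : bOfA a i = 1
    · -- all slots equal 1: the ray point `(N;1⁷)`, base on the axis, slot 1
      have hz : ∀ m ∈ Icc 1 7, bOfA (a - dsUp) m = 0 := by
        intro m hm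
        have hm7 : m ≤ 7 := (mem_Icc.1 hm).2
        have hm0 : m ≠ 0 := by have := (mem_Icc.1 hm).1; omega
        have := hmax m hm
        have := hpos m hm
        rw [bOfA_sub_dsUp a m hm7, if_neg hm0]; omega
      exact ⟨1, by simp, hAx (a - dsUp) j j j hz r₀ r₁ (r₂ (by simp))⟩
    · -- `b_i ≥ 2` but `b_i + 2 > N`: then `N = 3`, and slot 1 or slot 2 equals 1 (`(1,2)` is an E-pair)
      have h1 := hpos 1 (by simp)
      have h2 := hpos 2 (by simp)
      have hm1 := hmax 1 (by simp)
      have hm2 := hmax 2 (by simp)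
      have hpi := hpos i hi
      have hN3 : bOfA a 0 = 3 ∧ (bOfA a 1 = 1 ∨ bOfA a 2 = 1) := by
        simp only [bOfA] at h1 h2 hm1 hm2 ⊢
        interval_cases i <;> simp only [bOfA] at hbi hint hone hpi ⊢ <;> omega
      obtain ⟨hN, h12⟩ := hN3
      have hlev : bOfA (a - dsUp) 0 = 1 := by rw [bOfA_sub_dsUp a 0 (by norm_num), if_pos rfl, hN]; norm_num
      rcases h12 with h | h
      · refine ⟨1, by simp, hL1 (a - dsUp) 1 j j j (by simp) hlev ?_ r₀ r₁ (r₂ (by simp))⟩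
        rw [bOfA_sub_dsUp a 1 (by norm_num), if_neg (by norm_num), h]; norm_num
      · refine ⟨2, by simp, hL1 (a - dsUp) 2 j j j (by simp) hlev ?_ r₀ r₁ (r₂ (by simp))⟩
        rw [bOfA_sub_dsUp a 2 (by norm_num), if_neg (by norm_num), h]; norm_num

/-! ## 2. The descent from an instance provider -/

/-- **Level descent from a pencil-instance provider.** gen-1's `explicitPQAt_level_of_terminal` with the pencil step
run at the slot delivered by `hinst` (one dictionary pencil instance at the base `a − DS` per interior point). -/
theorem explicitPQAt_level_of_provider (hcS : CellStar) (hdS : DictStar) (hcP : CellPencil) {N : ℤ}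
    (hinst : ∀ (a : Fin 8 → ℤ) (j : ℕ), RegionHyp a j → (∀ m ∈ Icc 1 7, 1 ≤ bOfA a m) →
      ∃ i ∈ Icc 1 7, DictThreeTerm (pencilBase (bOfA (a - dsUp))) (pencilApex (bOfA (a - dsUp)) i)
        (fanCoeff (bOfA (a - dsUp + dsUp)) i) (a - dsUp) (a - dsUp + dsUp) (a - dsUp + dsUp + slotDown i) j j j)
    (hlow : ∀ (c : Fin 8 → ℤ) (j : ℕ), bOfA c 0 = N - 2 → RegionHyp c j → ExplicitPQAt c j)
    (hterm : ∀ (a : Fin 8 → ℤ) (j : ℕ), bOfA a 0 = N → Terminal a → RegionHyp a j → ExplicitPQAt a j) :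
    ∀ (a : Fin 8 → ℤ) (j : ℕ), bOfA a 0 = N → RegionHyp a j → ExplicitPQAt a j := by
  suffices H : ∀ s : ℕ, ∀ (a : Fin 8 → ℤ) (j : ℕ), bOfA a 0 = N → RegionHyp a j → (slotSum a).toNat = s →
      ExplicitPQAt a j from fun a j hN hr => H _ a j hN hr rfl
  intro s
  induction s using Nat.strong_induction_on with
  | _ s ih =>
    intro a j hN hr hs
    have hbox := hr.2.2.1
    have hb1 := hbox 1 (by simp)
    have hb2 := hbox 2 (by simp)
    have hb3 := hbox 3 (by simp)
    have hb4 := hbox 4 (by simp)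
    have hb5 := hbox 5 (by simp)
    have hb6 := hbox 6 (by simp)
    have hb7 := hbox 7 (by simp)
    have hss : 0 ≤ slotSum a := by
      simp only [slotSum]
      omega
    by_cases hpos : ∀ i ∈ Icc 1 7, 1 ≤ bOfA a i
    · -- PENCIL step at the slot of `pencil_instance`: base `a − DS` (level `N − 2`), third point `a − s_i`
      have h₀ : ExplicitPQAt (a - dsUp) j :=
        hlow (a - dsUp) j (by rw [bOfA_sub_dsUp a 0 (by norm_num), if_pos rfl, hN]) (regionHyp_sub_dsUp hr hpos)
      obtain ⟨i, hi, hdic⟩ := hinst a j hr hpos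
      have hi1 : 1 ≤ i := (mem_Icc.1 hi).1
      have hge : bOfA a i ≤ slotSum a := le_slotSum hr hi
      have hpi := hpos i hi
      have hlt : (slotSum (a + slotDown i)).toNat < s := by
        rw [slotSum_add_slotDown a hi]
        omega
      have hN' : bOfA (a + slotDown i) 0 = N := by
        rw [bOfA_add_slotDown a i hi 0 (by norm_num), if_neg (by omega)]
        exact hN
      have h₂ : ExplicitPQAt (a + slotDown i) j :=
        ih _ hlt (a + slotDown i) j hN' (regionHyp_slotDown hr hi hpi) rfl
      exact descent_pencil_slot hcP hi hr hpos hdic h₀ h₂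
    · push Not at hpos
      obtain ⟨i₀, hi₀, hz⟩ := hpos
      by_cases hdis : ∃ p ∈ Icc 1 7, ∃ q ∈ Icc 1 7, bOfA a p ≠ 0 ∧ bOfA a q ≠ 0 ∧ bOfA a p ≠ bOfA a q
      · -- STAR step (verbatim from gen-1): both other members have smaller slot sum
        obtain ⟨p, hp, q, hq, hp0, hq0, hpq⟩ := hdis
        have hp1 : 1 ≤ bOfA a p := by
          have := hbox p hp
          omega
        have hq1 : 1 ≤ bOfA a q := by
          have := hbox q hq
          omega
        have hp' : 1 ≤ p := (mem_Icc.1 hp).1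
        have hq' : 1 ≤ q := (mem_Icc.1 hq).1
        have hNq : bOfA (a + slotDown q) 0 = N := by
          rw [bOfA_add_slotDown a q hq 0 (by norm_num), if_neg (show (0 : ℕ) ≠ q by omega)]
          exact hN
        have hNp : bOfA (a + slotDown p) 0 = N := by
          rw [bOfA_add_slotDown a p hp 0 (by norm_num), if_neg (show (0 : ℕ) ≠ p by omega)]
          exact hN
        have hgeq : bOfA a q ≤ slotSum a := le_slotSum hr hq
        have hltq : (slotSum (a + slotDown q)).toNat < s := by
          rw [slotSum_add_slotDown a hq]
          omega
        have hltp : (slotSum (a + slotDown p)).toNat < s := by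
          rw [slotSum_add_slotDown a hp]
          have hgep : bOfA a p ≤ slotSum a := le_slotSum hr hp
          omega
        have h₁ : ExplicitPQAt (a + slotDown q) j :=
          ih _ hltq (a + slotDown q) j hNq (regionHyp_slotDown hr hq hq1) rfl
        have h₂ : ExplicitPQAt (a + slotDown p) j :=
          ih _ hltp (a + slotDown p) j hNp (regionHyp_slotDown hr hp hp1) rfl
        exact descent_star hcS hdS hr hp hq hp1 hq1 hpq h₁ h₂
      · -- terminal
        have hT : Terminal a := by
          refine ⟨⟨i₀, hi₀, ?_⟩, ?_⟩
          · have := hbox i₀ hi₀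
            omega
          · intro p hp q hq hp0 hq0
            by_contra hne
            exact hdis ⟨p, hp, q, hq, hp0, hq0, hne⟩
        exact hterm a j hN hT hr

/-- **THE DESCENT FROM A PROVIDER (PROVED).** Under `CellStar`, `DictStar`, `CellPencil` and a provider of ONE
dictionary pencil instance at the base `a − DS` of every region point with all slots `≥ 1`, `explicitPQ` holds as soon
as it holds at every terminal region point (gen-1's interface). -/
theorem explicitPQ_of_provider (hcS : CellStar) (hdS : DictStar) (hcP : CellPencil)
    (hinst : ∀ (a : Fin 8 → ℤ) (j : ℕ), RegionHyp a j → (∀ m ∈ Icc 1 7, 1 ≤ bOfA a m) →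
      ∃ i ∈ Icc 1 7, DictThreeTerm (pencilBase (bOfA (a - dsUp))) (pencilApex (bOfA (a - dsUp)) i)
        (fanCoeff (bOfA (a - dsUp + dsUp)) i) (a - dsUp) (a - dsUp + dsUp) (a - dsUp + dsUp + slotDown i) j j j)
    (hterm : ∀ (a : Fin 8 → ℤ) (j : ℕ), Terminal a → RegionHyp a j →
      (∀ (c : Fin 8 → ℤ) (j' : ℕ), bOfA c 0 < bOfA a 0 → RegionHyp c j' → ExplicitPQAt c j') → ExplicitPQAt a j) :
    explicitPQ := by
  rw [explicitPQ_iff_at]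
  suffices H : ∀ n : ℕ, ∀ (a : Fin 8 → ℤ) (j : ℕ), (bOfA a 0).toNat = n → RegionHyp a j → ExplicitPQAt a j from
    fun a j hr => H _ a j rfl hr
  intro n
  induction n using Nat.strong_induction_on with
  | _ n ih =>
    intro a j hn hr
    have hN0 : 0 ≤ bOfA a 0 := level_nonneg hr
    refine explicitPQAt_level_of_provider hcS hdS hcP (N := bOfA a 0) hinst ?_ ?_ a j rfl hr
    · intro c j' hc hr'
      have hc0 : 0 ≤ bOfA c 0 := level_nonneg hr'
      have hlt : (bOfA c 0).toNat < n := by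
        rw [← hn]
        omega
      exact ih _ hlt c j' rfl hr'
    · intro a' j' ha' hT hr'
      refine hterm a' j' hT hr' ?_
      intro c j'' hlt' hrc
      have hc0 : 0 ≤ bOfA c 0 := level_nonneg hrc
      exact ih _ (by omega) c j'' rfl hrc

/-- **THE SHARP FORM (PROVED).**  The same with `DictPencil` replaced by the two thinner nodes `DictPencilAxis` (the ray:
one instance per level) and `DictPencilLevelOne` (finitely many instances). -/
theorem explicitPQ_of_terminal_sharp (hcS : CellStar) (hdS : DictStar) (hcP : CellPencil) (hAx : DictPencilAxis)
    (hL1 : DictPencilLevelOne)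
    (hterm : ∀ (a : Fin 8 → ℤ) (j : ℕ), Terminal a → RegionHyp a j →
      (∀ (c : Fin 8 → ℤ) (j' : ℕ), bOfA c 0 < bOfA a 0 → RegionHyp c j' → ExplicitPQAt c j') → ExplicitPQAt a j) :
    explicitPQ :=
  explicitPQ_of_provider hcS hdS hcP (fun _ _ hr hpos => pencil_instance_sharp hAx hL1 hr hpos) hterm

/-- Shape sanity: E-L23's `explicitPQ_of_terminal_zero` is recovered from the sharp form. -/
theorem explicitPQ_of_terminal_zero' (hcS : CellStar) (hdS : DictStar) (hcP : CellPencil) (hdP0 : DictPencilZero)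
    (hterm : ∀ (a : Fin 8 → ℤ) (j : ℕ), Terminal a → RegionHyp a j →
      (∀ (c : Fin 8 → ℤ) (j' : ℕ), bOfA c 0 < bOfA a 0 → RegionHyp c j' → ExplicitPQAt c j') → ExplicitPQAt a j) :
    explicitPQ :=
  explicitPQ_of_terminal_sharp hcS hdS hcP (dictPencilAxis_of_zero hdP0) (dictPencilLevelOne_of_zero hdP0) hterm

end Summit.KontsevichZagierPeriods.Zeta5Search.Elimination
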